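import Summits.Parity.GeneralizedHardyLittlewood.Theorems.BeyondDiagonalBeatsQuarter.OffDiagPoissonTwistedLattice
import HarnessLib

/-!
# Route `PrimeLevelFamEdge`, crux K_B (stmt-Parity-20343), line `diagonal_kernel_split` rev 4, plan Ω,
# lemma **L2 `OffDiagDualTruncation`** (part 1, generic): order-`k` decay of `fourier2` and the lattice tails

OMEGA-BLUEPRINT §3 L2 («dual lengths», GATE G2 §(a) row a5): after Poisson summation (d1/d5) the dual sum
`Σ_{h ∈ ℤ²} Φ̂_i(h/(qr))·N(h)` must be truncated at `|h_j| ≤ H_j q^{ε}`. This file is the GENERIC half: for a weight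
`Φ : ℝ → ℝ → ℂ` (box support, smooth slices — the FI toolkit hypotheses — or simply `uncurry Φ` smooth of compact
support), with `Φ̂ = FriedlanderIwaniecPrimes.fourier2 Φ`,

* §1 `k`-fold partial integration in each variable (the tree's `norm_fourier2_le_left/right/mixed` from order `2`
  to order `k`, same proofs with `norm_fourier_le_div … k`): `‖Φ̂(ξ₁,ξ₂)‖ ≤ (2π|ξ₁|)^{−k} ∫∫‖∂₁^kΦ‖`
  (`norm_fourier2_le_left_pow`), `≤ (2π|ξ₂|)^{−k} ∫∫‖∂₂^kΦ‖` (`…_right_pow`), and the mixed order `(k,2)`: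
  `≤ (2π|ξ₁|)^{−k}(2π|ξ₂|)^{−2} ∫∫‖∂₁^k∂₂²Φ‖` (`…_mixed_pow`); transposition `fourier2_transpose`; smooth forms
  `…_of_contDiff` with the derivatives written as iterated slice derivatives (no `Θ` bookkeeping for the consumer);
* §2 (companion file `OffDiagDualTruncationTails`) the lattice tails: for `c > 0`, `k ≥ 2`, `H ≥ 1`,
  `Σ_{h ∈ ℤ², |h₁| > H} ‖Φ̂(h₁/c, h₂/c)‖ ≤ 2 (c/2π)^k (A_k + (c²/12)·B_k) · H^{1−k}`,
  `A_k = ∫∫‖∂₁^kΦ‖`, `B_k = ∫∫‖∂₁^k∂₂²Φ‖`, and the same in `h₂` by transposition. With `H = H_j q^{ε}`,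
  `H_j = c·(cost per derivative)`, this is the `q^{−(k−1)ε}` truncation once the derivative costs `A_k, B_k` of
  the box weights are known (L2c).

Folklore Fourier analysis, PROVED; theorems only. Helper; closes nothing.
«The programme SEARCHES and TYPES; no claim about Landau–Siegel zeros, Theorems 1–2 of arXiv:2211.02515 or
a repaired Margin232 until a kernel theorem says so.»
-/

noncomputable section

open Real MeasureTheory Complex Finset Set
open scoped FourierTransform Topology ContDiff

namespace Summit.Parity.GeneralizedHardyLittlewood.Theorems.BeyondDiagonalBeatsQuarter.OffDiagPoissonTwisted

open Literature.NumberTheory.Sieve.FriedlanderIwaniecPrimes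

/-! ### §1 Order-`k` partial integration for `fourier2` -/

section OrderK

variable {Φ : ℝ → ℝ → ℂ} {R : ℝ}

/-- **Transposition**: `Φ̂(ξ₁,ξ₂) = (Φᵀ)^(ξ₂,ξ₁)`, `Φᵀ(t₂,t₁) = Φ(t₁,t₂)` (Fubini, the tree's `fourier2_eq_swap`).
[folklore] -/
theorem fourier2_transpose (h : BoxSupport Φ R) (hc : Continuous (Function.uncurry Φ)) (ξ₁ ξ₂ : ℝ) :
    fourier2 (fun t₂ t₁ => Φ t₁ t₂) ξ₂ ξ₁ = fourier2 Φ ξ₁ ξ₂ := by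
  rw [fourier2_eq_swap h hc, fourier2, fourier_eq_integral_ker]
  rfl

/-- Box support and continuity pass to the transpose. [folklore] -/
theorem boxSupport_transpose (h : BoxSupport Φ R) : BoxSupport (fun t₂ t₁ => Φ t₁ t₂) R :=
  fun t₂ t₁ hne => ⟨(h t₁ t₂ hne).2, (h t₁ t₂ hne).1⟩

/-- Continuity of the transpose. [folklore] -/
theorem continuous_uncurry_transpose (hc : Continuous (Function.uncurry Φ)) :
    Continuous (Function.uncurry fun t₂ t₁ => Φ t₁ t₂) :=
  hc.comp (continuous_snd.prodMk continuous_fst)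

/-- **`k` partial integrations in `t₁`**: with `∂₁^kΦ = Θ` jointly continuous of box support,
`‖Φ̂(ξ₁,ξ₂)‖ ≤ (2π|ξ₁|)^{−k} ∫∫‖Θ‖` (`ξ₁ ≠ 0`). [folklore] -/
theorem norm_fourier2_le_left_pow (h : BoxSupport Φ R) (hc : Continuous (Function.uncurry Φ))
    (hs : ∀ t₂, ContDiff ℝ ∞ (fun t₁ => Φ t₁ t₂)) (k : ℕ) {Θ : ℝ → ℝ → ℂ}
    (hΘ : ∀ t₂, iteratedDeriv k (fun t₁ => Φ t₁ t₂) = fun t₁ => Θ t₁ t₂)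
    (hΘs : BoxSupport Θ R) (hΘc : Continuous (Function.uncurry Θ)) {ξ₁ : ℝ} (hξ₁ : ξ₁ ≠ 0) (ξ₂ : ℝ) :
    ‖fourier2 Φ ξ₁ ξ₂‖ ≤ ((2 * π * |ξ₁|) ^ k)⁻¹ * ∫ t₂, ∫ t₁, ‖Θ t₁ t₂‖ := by
  rw [fourier2_eq_swap h hc]
  refine (norm_integral_le_integral_norm _).trans ?_
  have hpt : ∀ t₂, ‖ker t₂ ξ₂ * 𝓕 (fun t₁ => Φ t₁ t₂) ξ₁‖ ≤
      ((2 * π * |ξ₁|) ^ k)⁻¹ * ∫ t₁, ‖Θ t₁ t₂‖ := by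
    intro t₂
    rw [norm_mul, norm_ker, one_mul]
    have := norm_fourier_le_div (hs t₂) (h.hasCompactSupport_left t₂) k hξ₁
    rw [hΘ t₂] at this
    rw [inv_mul_eq_div]
    exact this
  refine (integral_mono_of_nonneg (Filter.Eventually.of_forall fun t₂ => norm_nonneg _)
    ((integrable_integral_norm_left hΘs hΘc).const_mul _) (Filter.Eventually.of_forall hpt)).trans (le_of_eq ?_)
  exact integral_const_mul _ _

/-- **`k` partial integrations in `t₂`**: with `∂₂^kΦ = Θ₂` jointly continuous of box support,
`‖Φ̂(ξ₁,ξ₂)‖ ≤ (2π|ξ₂|)^{−k} ∫∫‖Θ₂‖` (`ξ₂ ≠ 0`). [folklore] -/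
theorem norm_fourier2_le_right_pow (h : BoxSupport Φ R) (hs : ∀ t₁, ContDiff ℝ ∞ (Φ t₁)) (k : ℕ)
    {Θ₂ : ℝ → ℝ → ℂ} (hΘ : ∀ t₁, iteratedDeriv k (Φ t₁) = Θ₂ t₁) (hΘs : BoxSupport Θ₂ R)
    (hΘc : Continuous (Function.uncurry Θ₂)) (ξ₁ : ℝ) {ξ₂ : ℝ} (hξ₂ : ξ₂ ≠ 0) :
    ‖fourier2 Φ ξ₁ ξ₂‖ ≤ ((2 * π * |ξ₂|) ^ k)⁻¹ * ∫ t₁, ∫ t₂, ‖Θ₂ t₁ t₂‖ := by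
  rw [fourier2]
  refine (norm_fourier_le_integral_norm _ _).trans ?_
  have hpt : ∀ t₁, ‖sliceFourier Φ ξ₂ t₁‖ ≤ ((2 * π * |ξ₂|) ^ k)⁻¹ * ∫ t₂, ‖Θ₂ t₁ t₂‖ := by
    intro t₁
    rw [sliceFourier]
    have := norm_fourier_le_div (hs t₁) (h.hasCompactSupport_right t₁) k hξ₂
    rw [hΘ t₁] at this
    rw [inv_mul_eq_div]
    exact this
  refine (integral_mono_of_nonneg (Filter.Eventually.of_forall fun t₁ => norm_nonneg _)
    ((integrable_integral_norm_right hΘs hΘc).const_mul _) (Filter.Eventually.of_forall hpt)).trans (le_of_eq ?_)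
  exact integral_const_mul _ _

/-- **Mixed order `(k, 2)`**: with `∂₂²Φ = Θ₂` and `∂₁^kΘ₂ = Θ₂ₖ`, all jointly continuous of box support,
`‖Φ̂(ξ₁,ξ₂)‖ ≤ (2π|ξ₁|)^{−k}(2π|ξ₂|)^{−2} ∫∫‖Θ₂ₖ‖` (`ξ₁, ξ₂ ≠ 0`). [folklore] -/
theorem norm_fourier2_le_mixed_pow (h : BoxSupport Φ R) (hs₂ : ∀ t₁, ContDiff ℝ ∞ (Φ t₁))
    {Θ₂ : ℝ → ℝ → ℂ} (hΘ₂ : ∀ t₁, iteratedDeriv 2 (Φ t₁) = Θ₂ t₁) (hΘ₂s : BoxSupport Θ₂ R)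
    (hΘ₂c : Continuous (Function.uncurry Θ₂)) (hΘ₂d : ∀ t₂, ContDiff ℝ ∞ (fun t₁ => Θ₂ t₁ t₂)) (k : ℕ)
    {Θ₂ₖ : ℝ → ℝ → ℂ} (hΘ₂ₖ : ∀ t₂, iteratedDeriv k (fun t₁ => Θ₂ t₁ t₂) = fun t₁ => Θ₂ₖ t₁ t₂)
    (hΘ₂ₖs : BoxSupport Θ₂ₖ R) (hΘ₂ₖc : Continuous (Function.uncurry Θ₂ₖ))
    {ξ₁ ξ₂ : ℝ} (hξ₁ : ξ₁ ≠ 0) (hξ₂ : ξ₂ ≠ 0) :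
    ‖fourier2 Φ ξ₁ ξ₂‖ ≤
      ((2 * π * |ξ₁|) ^ k)⁻¹ * ((2 * π * |ξ₂|) ^ 2)⁻¹ * ∫ t₂, ∫ t₁, ‖Θ₂ₖ t₁ t₂‖ := by
  rw [fourier2_eq_of_deriv h hs₂ hΘ₂ ξ₁ hξ₂, norm_mul, norm_inv, norm_pow]
  have e : ‖2 * (π : ℂ) * I * ξ₂‖ = 2 * π * |ξ₂| := by
    rw [norm_mul, norm_mul, norm_mul, Complex.norm_I, mul_one, Complex.norm_real, Complex.norm_real,
      Real.norm_eq_abs, Real.norm_eq_abs, abs_of_pos Real.pi_pos]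
    simp
  rw [e]
  have hb := norm_fourier2_le_left_pow hΘ₂s hΘ₂c hΘ₂d k hΘ₂ₖ hΘ₂ₖs hΘ₂ₖc hξ₁ ξ₂
  calc ((2 * π * |ξ₂|) ^ 2)⁻¹ * ‖fourier2 Θ₂ ξ₁ ξ₂‖
      ≤ ((2 * π * |ξ₂|) ^ 2)⁻¹ * (((2 * π * |ξ₁|) ^ k)⁻¹ * ∫ t₂, ∫ t₁, ‖Θ₂ₖ t₁ t₂‖) :=
        mul_le_mul_of_nonneg_left hb (by positivity)
    _ = _ := by ring

end OrderK

/-! ### §1' Smooth compactly supported weights: the bounds with iterated slice derivatives -/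

section Smooth

variable {Φ : ℝ → ℝ → ℂ}

/-- **`k` partial integrations in `t₁`, smooth form**: for `uncurry Φ` smooth of compact support and `ξ₁ ≠ 0`,
`‖Φ̂(ξ₁,ξ₂)‖ ≤ (2π|ξ₁|)^{−k} ∫ dt₂ ∫ dt₁ |∂₁^kΦ(t₁,t₂)|`. [folklore] -/
theorem norm_fourier2_le_left_pow_of_contDiff (hΦ : ContDiff ℝ ∞ (Function.uncurry Φ))
    (hΦc : HasCompactSupport (Function.uncurry Φ)) (k : ℕ) {ξ₁ : ℝ} (hξ₁ : ξ₁ ≠ 0) (ξ₂ : ℝ) :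
    ‖fourier2 Φ ξ₁ ξ₂‖ ≤
      ((2 * π * |ξ₁|) ^ k)⁻¹ * ∫ t₂, ∫ t₁, ‖iteratedDeriv k (fun s => Φ s t₂) t₁‖ := by
  obtain ⟨R, -, hR⟩ := exists_tsupport_subset_box hΦc
  obtain ⟨_, h₁c, h₁s, -⟩ := sliceField_props hΦ hR (uncurry_iteratedDeriv_slice_left hΦ k)
  exact norm_fourier2_le_left_pow (boxSupport_of_tsupport_subset hR) hΦ.continuous (contDiff_slice_left hΦ) k
    (Θ := fun t₁ t₂ => iteratedDeriv k (fun s => Φ s t₂) t₁) (fun _ => rfl) h₁s h₁c hξ₁ ξ₂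

/-- **`k` partial integrations in `t₂`, smooth form**: `‖Φ̂(ξ₁,ξ₂)‖ ≤ (2π|ξ₂|)^{−k} ∫ dt₁ ∫ dt₂ |∂₂^kΦ(t₁,t₂)|`
(`ξ₂ ≠ 0`). [folklore] -/
theorem norm_fourier2_le_right_pow_of_contDiff (hΦ : ContDiff ℝ ∞ (Function.uncurry Φ))
    (hΦc : HasCompactSupport (Function.uncurry Φ)) (k : ℕ) (ξ₁ : ℝ) {ξ₂ : ℝ} (hξ₂ : ξ₂ ≠ 0) :
    ‖fourier2 Φ ξ₁ ξ₂‖ ≤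
      ((2 * π * |ξ₂|) ^ k)⁻¹ * ∫ t₁, ∫ t₂, ‖iteratedDeriv k (Φ t₁) t₂‖ := by
  obtain ⟨R, -, hR⟩ := exists_tsupport_subset_box hΦc
  obtain ⟨_, h₂c, h₂s, -⟩ := sliceField_props hΦ hR (uncurry_iteratedDeriv_slice_right hΦ k)
  exact norm_fourier2_le_right_pow (boxSupport_of_tsupport_subset hR) (contDiff_slice_right hΦ) k
    (Θ₂ := fun t₁ t₂ => iteratedDeriv k (Φ t₁) t₂) (fun _ => rfl) h₂s h₂c ξ₁ hξ₂

/-- **Mixed order `(k,2)`, smooth form**: `‖Φ̂(ξ₁,ξ₂)‖ ≤ (2π|ξ₁|)^{−k}(2π|ξ₂|)^{−2} ∫ dt₂ ∫ dt₁ |∂₁^k∂₂²Φ(t₁,t₂)|`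
(`ξ₁, ξ₂ ≠ 0`; the inner derivative is `∂₂²`, then `∂₁^k`). [folklore] -/
theorem norm_fourier2_le_mixed_pow_of_contDiff (hΦ : ContDiff ℝ ∞ (Function.uncurry Φ))
    (hΦc : HasCompactSupport (Function.uncurry Φ)) (k : ℕ) {ξ₁ ξ₂ : ℝ} (hξ₁ : ξ₁ ≠ 0) (hξ₂ : ξ₂ ≠ 0) :
    ‖fourier2 Φ ξ₁ ξ₂‖ ≤ ((2 * π * |ξ₁|) ^ k)⁻¹ * ((2 * π * |ξ₂|) ^ 2)⁻¹ *
      ∫ t₂, ∫ t₁, ‖iteratedDeriv k (fun s => iteratedDeriv 2 (Φ s) t₂) t₁‖ := by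
  obtain ⟨R, -, hR⟩ := exists_tsupport_subset_box hΦc
  obtain ⟨h₂sm, h₂c, h₂s, h₂R⟩ := sliceField_props hΦ hR (uncurry_iteratedDeriv_slice_right hΦ 2)
  obtain ⟨_, h₃c, h₃s, -⟩ := sliceField_props h₂sm h₂R (uncurry_iteratedDeriv_slice_left h₂sm k)
  exact norm_fourier2_le_mixed_pow (boxSupport_of_tsupport_subset hR) (contDiff_slice_right hΦ)
    (Θ₂ := fun t₁ t₂ => iteratedDeriv 2 (Φ t₁) t₂) (fun _ => rfl) h₂s h₂c (contDiff_slice_left h₂sm) k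
    (Θ₂ₖ := fun t₁ t₂ => iteratedDeriv k (fun s => iteratedDeriv 2 (Φ s) t₂) t₁) (fun _ => rfl)
    h₃s h₃c hξ₁ hξ₂

/-- The transpose of a smooth compactly supported weight is smooth of compact support. [folklore] -/
theorem contDiff_hasCompactSupport_transpose (hΦ : ContDiff ℝ ∞ (Function.uncurry Φ))
    (hΦc : HasCompactSupport (Function.uncurry Φ)) :
    ContDiff ℝ ∞ (Function.uncurry fun t₂ t₁ => Φ t₁ t₂) ∧
      HasCompactSupport (Function.uncurry fun t₂ t₁ => Φ t₁ t₂) := by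
  have e : (Function.uncurry fun t₂ t₁ => Φ t₁ t₂) = Function.uncurry Φ ∘ (Equiv.prodComm ℝ ℝ) := by
    funext p; rfl
  rw [e]
  exact ⟨hΦ.comp (contDiff_snd.prodMk contDiff_fst),
    hΦc.comp_homeomorph (Homeomorph.prodComm ℝ ℝ)⟩

/-- Transposition for a smooth compactly supported weight: `Φ̂(ξ₁,ξ₂) = (Φᵀ)^(ξ₂,ξ₁)`. [folklore] -/
theorem fourier2_transpose_of_contDiff (hΦ : ContDiff ℝ ∞ (Function.uncurry Φ))
    (hΦc : HasCompactSupport (Function.uncurry Φ)) (ξ₁ ξ₂ : ℝ) :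
    fourier2 (fun t₂ t₁ => Φ t₁ t₂) ξ₂ ξ₁ = fourier2 Φ ξ₁ ξ₂ := by
  obtain ⟨R, -, hR⟩ := exists_tsupport_subset_box hΦc
  exact fourier2_transpose (boxSupport_of_tsupport_subset hR) hΦ.continuous ξ₁ ξ₂

end Smooth

end Summit.Parity.GeneralizedHardyLittlewood.Theorems.BeyondDiagonalBeatsQuarter.OffDiagPoissonTwisted
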